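import Summits.QuantumFields.QCD.Theorems.SpectralDefectExtinctionWegnerEstimateCoareaCore

/-!
# Bridge lemma N₂-Hölder toward the HÖLDER BRANCH of line `Sketch` (skeleton "ResolventCell", gen 2c) for
crux `SpectralDefectExtinction.WegnerEstimate` (item stmt-QuantumFields-8966):
the abstract core of the 1-D route WITHOUT the tube sum

Same abstract setting as the landed core `coareaWegner_core_lintegral_le` (p140792): a compact
second-countable group `G`, configurations `V : ι → G` under product Haar `μ`, a continuous
Hermitian-valued `H`, an observable `t(V)`, a continuous badness `b` whose one-link-saturated small
balls have measure `≤ C_B δ^m`, finitely many directions `d = (e_d, c_d)` with currents `J_d`, Lipschitz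
sorted eigenvalues along the circles and a uniform AREA BOUND `B`, and the pointwise rigidity bound
`t(V) ≤ A₀ + (c₀ b(V)^k)⁻¹ Σ_d Σ_j [|λ_j| ≤ 1] |J_d(V, u_j)| φ(λ_j)` for `b(V) > 0`.

The landed core needs `k < m` (integrability of `b^{-k}`, the tube sum).  Here ONLY `0 < m` is assumed,
at the price of a uniform bound `t ≤ T` and a threshold `δ₀ ∈ (0, 1]`:

  `∫⁻ t dμ ≤ A₀ + c₀⁻¹ · #directions · (2π)⁻¹ · B · δ₀^{-k} + T · #directions · C_B δ₀^m`

(`coareaWegner_coreBoundHolder`).  Proof: for each direction `d` split the configurations into the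
saturated bad set `bad_d = {V | ∃ g, b(V[e_d ↦ g]) < δ₀}` (measure `≤ C_B δ₀^m`, on it `t ≤ T`) and its
complement, on which `b ≥ δ₀` along the whole `e_d`-fibre, so the weight `b^{-k}` is replaced by the
CONSTANT `δ₀^{-k}`; the slice + circle-majorant + area part of the core proof is unchanged.  Optimising
`δ₀` against `ε` downstream gives an `ε^{-k/(m+k)}` local bound, i.e. a Hölder Wegner estimate with
exponent `α = m/(m+k)`.
-/

noncomputable section

namespace Summit.QuantumFields.QCD.Cruxes.WegnerEstimate.ResolventCell

open MeasureTheory Filter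
open scoped Matrix BigOperators ENNReal NNReal Topology
open Literature.MathematicalPhysics.QuantumLattice Literature.MathematicalPhysics.QuantumFieldTheory
  Literature.Probability.LatticeModels
open Matrix
open scoped ComplexOrder

section CoreHolder

variable {G : Type*} [Group G] [TopologicalSpace G] [IsTopologicalGroup G] [CompactSpace G]
  [MeasurableSpace G] [BorelSpace G] [SecondCountableTopology G]
  {ι : Type*} [Fintype ι] [DecidableEq ι]
  {n : Type*} [Fintype n] [DecidableEq n]

/-- **The abstract core of the 1-D route, Hölder branch (no tube sum).**  See the module docstring. -/
theorem coareaWegner_coreHolder_lintegral_le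
    (Hof : (ι → G) → Matrix n n ℂ) (hHof : Continuous Hof) (hHerm : ∀ V, (Hof V).IsHermitian)
    (tx : (ι → G) → ℝ)
    (b : (ι → G) → ℝ) (hbc : Continuous b)
    (φ : ℝ → ℝ) (hφ : Continuous φ) (hφ0 : ∀ E, 0 ≤ φ E)
    {A₀ c₀ C_B m : ℝ} {k : ℕ} (hA₀ : 0 ≤ A₀) (hc₀ : 0 < c₀) (hm : 0 < m)
    (T : ℝ) (htxT : ∀ V, tx V ≤ T)
    (δ₀ : ℝ) (hδ₀ : 0 < δ₀) (hδ₀1 : δ₀ ≤ 1)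
    (e₀ : ι)
    (hsmall : ∀ (e' : ι) (δ : ℝ), 0 < δ → δ ≤ 1 →
      (Measure.pi fun _ : ι => haarProbability G) {V : ι → G | ∃ g : G, b (Function.update V e' g) < δ} ≤
        ENNReal.ofReal (C_B * δ ^ m))
    {Dir : Type*} [Fintype Dir] (e : Dir → ι) (c : Dir → ℝ → G) (hc0 : ∀ d, c d 0 = 1)
    (hmul : ∀ d s t, c d (s + t) = c d s * c d t) (hcont : ∀ d, Continuous (c d))
    (J : Dir → (ι → G) → (n → ℂ) → ℝ)
    (hJ : ∀ d (V : ι → G) (ψ : n → ℂ),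
      HasDerivAt (fun s => (star ψ ⬝ᵥ (Hof (Function.update V (e d) (V (e d) * c d s))).mulVec ψ).re)
        (J d V ψ) 0)
    (hlip : ∀ d (V : ι → G), ∃ K : ℝ≥0, ∀ i : Fin (Fintype.card n),
      LipschitzWith K fun s => (hHerm (Function.update V (e d) (V (e d) * c d s))).eigenvalues₀ i)
    (hdiffH : ∀ d (V : ι → G), ∃ Hd : Matrix n n ℂ, ∀ p q,
      HasDerivAt (fun s => Hof (Function.update V (e d) (V (e d) * c d s)) p q) (Hd p q) 0)
    {B : ℝ≥0∞}
    (harea : ∀ d (V : ι → G), ∑ i : Fin (Fintype.card n), ∫⁻ t in Set.Icc 0 (2 * Real.pi),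
      ENNReal.ofReal (|deriv (fun s => (hHerm (Function.update V (e d) (V (e d) * c d s))).eigenvalues₀ i) t| *
        φ ((hHerm (Function.update V (e d) (V (e d) * c d t))).eigenvalues₀ i)) ≤ B)
    (hpt : ∀ V : ι → G, 0 < b V → tx V ≤ A₀ + (c₀ * b V ^ k)⁻¹ *
      ∑ d, ∑ j : n, (if |(hHerm V).eigenvalues j| ≤ 1 then
        |J d V ⇑((hHerm V).eigenvectorBasis j)| * φ ((hHerm V).eigenvalues j) else 0)) :
    ∫⁻ V, ENNReal.ofReal (tx V) ∂(Measure.pi fun _ : ι => haarProbability G) ≤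
      ENNReal.ofReal A₀ + ENNReal.ofReal c₀⁻¹ * (Fintype.card Dir *
        (ENNReal.ofReal (2 * Real.pi)⁻¹ * B * ENNReal.ofReal (δ₀ ^ k)⁻¹)) +
      ENNReal.ofReal T * (Fintype.card Dir * ENNReal.ofReal (C_B * δ₀ ^ m)) := by
  set μ : Measure (ι → G) := Measure.pi fun _ : ι => haarProbability G with hμ
  -- the fibre-minimised badness of each direction
  set md : Dir → (ι → G) → ℝ := fun d V =>
    sInf ((fun g : G => b (Function.update V (e d) g)) '' Set.univ) with hmd
  have hmd_cont : ∀ d, Continuous (md d) := fun d => (coareaWegner_fibreMin b hbc (e d)).1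
  have hmd_le : ∀ d V, md d V ≤ b V := fun d V => (coareaWegner_fibreMin b hbc (e d)).2.1 V
  have hmd_fib : ∀ d V (g' : G), md d (Function.update V (e d) g') = md d V := fun d V g' =>
    (coareaWegner_fibreMin b hbc (e d)).2.2.1 V g'
  have hmd_lt : ∀ d V (δ : ℝ), md d V < δ ↔ ∃ g : G, b (Function.update V (e d) g) < δ := fun d V δ =>
    (coareaWegner_fibreMin b hbc (e d)).2.2.2.1 V δ
  have hmd_small : ∀ d, μ {V | md d V < δ₀} ≤ ENNReal.ofReal (C_B * δ₀ ^ m) := by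
    intro d
    have : {V | md d V < δ₀} = {V : ι → G | ∃ g : G, b (Function.update V (e d) g) < δ₀} :=
      Set.ext fun V => hmd_lt d V δ₀
    rw [this]
    exact hsmall (e d) δ₀ hδ₀ hδ₀1
  have hbad_meas : ∀ d, MeasurableSet {V | md d V < δ₀} := fun d =>
    measurableSet_lt (hmd_cont d).measurable measurable_const
  -- the badness is positive a.e.
  have hb_small : ∀ (δ : ℝ), 0 < δ → δ ≤ 1 → μ {V | b V < δ} ≤ ENNReal.ofReal (C_B * δ ^ m) := by
    intro δ hδ hδ1
    refine le_trans (measure_mono fun V hV => ?_) (hsmall e₀ δ hδ hδ1)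
    exact ⟨V e₀, by simpa using hV⟩
  have hae_pos : ∀ᵐ V ∂μ, 0 < b V := by
    rw [ae_iff]
    refine coareaWegner_measure_zero_of_forall_small μ _ hm fun δ hδ hδ1 =>
      le_trans (measure_mono fun V hV => ?_) (hb_small δ hδ hδ1)
    simp only [Set.mem_setOf_eq, not_lt] at hV ⊢
    exact lt_of_le_of_lt hV hδ
  -- the canonical majorants
  set Rd : Dir → (ι → G) → ℝ := fun d V => ∑ i : Fin (Fintype.card n),
    |deriv (fun s => (hHerm (Function.update V (e d) (V (e d) * c d s))).eigenvalues₀ i) 0| *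
      φ ((hHerm V).eigenvalues₀ i) with hRd
  have hRd0 : ∀ d V, 0 ≤ Rd d V := fun d V =>
    Finset.sum_nonneg fun i _ => mul_nonneg (abs_nonneg _) (hφ0 _)
  have hRd_meas : ∀ d, Measurable fun V => ENNReal.ofReal (Rd d V) := fun d =>
    coareaWegner_majorant_measurable (e d) Hof hHerm (hcont d) hHof φ hφ
  have hRd_ae : ∀ d, ∀ᵐ V ∂μ,
      ∑ j : n, |J d V ⇑((hHerm V).eigenvectorBasis j)| * φ ((hHerm V).eigenvalues j) = Rd d V := fun d =>
    coareaWegner_majorant_ae_dominates (e d) Hof hHerm (hc0 d) (hmul d) (hcont d) hHof (hlip d) (hdiffH d)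
      (J d) (hJ d) φ
  -- the weights: the constant `δ₀^{-k}` on the good (saturated) set, `0` on the bad set
  set Md : Dir → (ι → G) → ℝ≥0∞ := fun d V =>
    Set.indicator {V | δ₀ ≤ md d V} (fun _ => ENNReal.ofReal (δ₀ ^ k)⁻¹) V with hMd
  have hgood_meas : ∀ d, MeasurableSet {V | δ₀ ≤ md d V} := fun d =>
    measurableSet_le measurable_const (hmd_cont d).measurable
  have hMd_meas : ∀ d, Measurable (Md d) := fun d => measurable_const.indicator (hgood_meas d)
  have hMd_fib : ∀ d V (g : G), Md d (Function.update V (e d) (V (e d) * g)) = Md d V := by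
    intro d V g
    simp only [hMd, Set.indicator_apply, Set.mem_setOf_eq, hmd_fib]
  have hMd_int : ∀ d, ∫⁻ V, Md d V ∂μ ≤ ENNReal.ofReal (δ₀ ^ k)⁻¹ := by
    intro d
    simp only [hMd]
    rw [lintegral_indicator_const (hgood_meas d)]
    calc ENNReal.ofReal (δ₀ ^ k)⁻¹ * μ {V | δ₀ ≤ md d V} ≤ ENNReal.ofReal (δ₀ ^ k)⁻¹ * 1 :=
          mul_le_mul' le_rfl prob_le_one
      _ = ENNReal.ofReal (δ₀ ^ k)⁻¹ := mul_one _
  -- the bad-set penalty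
  set Pd : Dir → (ι → G) → ℝ≥0∞ := fun d V =>
    Set.indicator {V | md d V < δ₀} (fun _ => ENNReal.ofReal T) V with hPd
  have hPd_meas : ∀ d, Measurable (Pd d) := fun d => measurable_const.indicator (hbad_meas d)
  have hPd_int : ∀ d, ∫⁻ V, Pd d V ∂μ ≤ ENNReal.ofReal T * ENNReal.ofReal (C_B * δ₀ ^ m) := by
    intro d
    simp only [hPd]
    rw [lintegral_indicator_const (hbad_meas d)]
    exact mul_le_mul' le_rfl (hmd_small d)
  -- the a.e. pointwise bound in measurable terms
  have hptae : ∀ᵐ V ∂μ, ENNReal.ofReal (tx V) ≤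
      (ENNReal.ofReal A₀ + ENNReal.ofReal c₀⁻¹ * ∑ d, Md d V * ENNReal.ofReal (Rd d V)) + ∑ d, Pd d V := by
    filter_upwards [hae_pos, ae_all_iff.2 hRd_ae] with V hbV hVR
    by_cases hbad : ∃ d, md d V < δ₀
    · -- a bad configuration: `t ≤ T`, paid by the penalty of that direction
      obtain ⟨d₁, hd₁⟩ := hbad
      have h1 : ENNReal.ofReal (tx V) ≤ Pd d₁ V := by
        have hmem : V ∈ {V | md d₁ V < δ₀} := hd₁
        simp only [hPd, Set.indicator_of_mem hmem]
        exact ENNReal.ofReal_le_ofReal (htxT V)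
      have h2 : Pd d₁ V ≤ ∑ d, Pd d V :=
        Finset.single_le_sum (f := fun d => Pd d V) (fun d _ => zero_le) (Finset.mem_univ d₁)
      exact h1.trans (h2.trans le_add_self)
    · -- a good configuration: `b ≥ δ₀` along every fibre through `V`
      push Not at hbad
      have hcut : ∀ d, ∑ j : n, (if |(hHerm V).eigenvalues j| ≤ 1 then
          |J d V ⇑((hHerm V).eigenvectorBasis j)| * φ ((hHerm V).eigenvalues j) else 0) ≤ Rd d V := by
        intro d
        rw [← hVR d]
        refine Finset.sum_le_sum fun j _ => ?_
        split_ifs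
        · exact le_rfl
        · exact mul_nonneg (abs_nonneg _) (hφ0 _)
      have hw : ∀ d : Dir, (c₀ * b V ^ k)⁻¹ ≤ c₀⁻¹ * (δ₀ ^ k)⁻¹ := by
        intro d
        rw [mul_inv]
        refine mul_le_mul_of_nonneg_left ?_ (inv_nonneg.2 hc₀.le)
        exact inv_anti₀ (pow_pos hδ₀ k) (pow_le_pow_left₀ hδ₀.le ((hbad d).trans (hmd_le d V)) k)
      have hreal : tx V ≤ A₀ + c₀⁻¹ * ∑ d, (δ₀ ^ k)⁻¹ * Rd d V := by
        refine (hpt V hbV).trans (add_le_add le_rfl ?_)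
        rw [Finset.mul_sum, Finset.mul_sum]
        refine Finset.sum_le_sum fun d _ => ?_
        calc (c₀ * b V ^ k)⁻¹ * ∑ j : n, (if |(hHerm V).eigenvalues j| ≤ 1 then
              |J d V ⇑((hHerm V).eigenvectorBasis j)| * φ ((hHerm V).eigenvalues j) else 0)
            ≤ (c₀⁻¹ * (δ₀ ^ k)⁻¹) * Rd d V :=
              mul_le_mul (hw d) (hcut d) (Finset.sum_nonneg fun j _ => by
                split_ifs
                · exact mul_nonneg (abs_nonneg _) (hφ0 _)
                · exact le_rfl) (mul_nonneg (inv_nonneg.2 hc₀.le) (inv_nonneg.2 (pow_nonneg hδ₀.le k)))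
          _ = c₀⁻¹ * ((δ₀ ^ k)⁻¹ * Rd d V) := by ring
      have hMdV : ∀ d, Md d V = ENNReal.ofReal (δ₀ ^ k)⁻¹ := by
        intro d
        have hmem : V ∈ {V | δ₀ ≤ md d V} := hbad d
        simp only [hMd, Set.indicator_of_mem hmem]
      have hsum0 : 0 ≤ ∑ d, (δ₀ ^ k)⁻¹ * Rd d V :=
        Finset.sum_nonneg fun d _ => mul_nonneg (inv_nonneg.2 (pow_nonneg hδ₀.le k)) (hRd0 d V)
      calc ENNReal.ofReal (tx V) ≤ ENNReal.ofReal (A₀ + c₀⁻¹ * ∑ d, (δ₀ ^ k)⁻¹ * Rd d V) :=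
            ENNReal.ofReal_le_ofReal hreal
        _ = ENNReal.ofReal A₀ + ENNReal.ofReal c₀⁻¹ * ∑ d, Md d V * ENNReal.ofReal (Rd d V) := by
            rw [ENNReal.ofReal_add hA₀ (mul_nonneg (inv_nonneg.2 hc₀.le) hsum0),
              ENNReal.ofReal_mul (inv_nonneg.2 hc₀.le), ENNReal.ofReal_sum_of_nonneg
                (fun d _ => mul_nonneg (inv_nonneg.2 (pow_nonneg hδ₀.le k)) (hRd0 d V))]
            congr 2
            refine Finset.sum_congr rfl fun d _ => ?_
            rw [ENNReal.ofReal_mul (inv_nonneg.2 (pow_nonneg hδ₀.le k)), hMdV d]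
        _ ≤ _ := le_self_add
  -- circle bounds for the majorants
  have hcircle : ∀ d (V : ι → G), ∫⁻ t in Set.Ioc 0 (2 * Real.pi),
      ENNReal.ofReal (Rd d (Function.update V (e d) (V (e d) * c d t))) ≤ B := by
    intro d V
    exact (coareaWegner_majorant_circle_lintegral (e d) Hof hHerm (hmul d) (hcont d) hHof φ hφ hφ0 V).trans
      (harea d V)
  -- integrate
  have hdir : ∀ d, ∫⁻ V, Md d V * ENNReal.ofReal (Rd d V) ∂μ ≤
      ENNReal.ofReal (2 * Real.pi)⁻¹ * B * ENNReal.ofReal (δ₀ ^ k)⁻¹ := by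
    intro d
    refine (coareaWegner_lintegral_mul_le_of_circle_bound (e d) (hcont d).measurable (hMd_meas d)
      (hRd_meas d) (hMd_fib d) (hcircle d)).trans ?_
    exact mul_le_mul' le_rfl (hMd_int d)
  have hprod : ∀ d, Measurable fun V : ι → G => Md d V * ENNReal.ofReal (Rd d V) := fun d =>
    Measurable.mul (hMd_meas d) (hRd_meas d)
  have hsum : Measurable fun V : ι → G => ∑ d, Md d V * ENNReal.ofReal (Rd d V) :=
    Finset.measurable_sum _ fun d _ => hprod d
  have hmain : Measurable fun V : ι → G =>
      ENNReal.ofReal A₀ + ENNReal.ofReal c₀⁻¹ * ∑ d, Md d V * ENNReal.ofReal (Rd d V) :=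
    measurable_const.add (hsum.const_mul _)
  calc ∫⁻ V, ENNReal.ofReal (tx V) ∂μ
      ≤ ∫⁻ V, ((ENNReal.ofReal A₀ + ENNReal.ofReal c₀⁻¹ * ∑ d, Md d V * ENNReal.ofReal (Rd d V)) +
          ∑ d, Pd d V) ∂μ := lintegral_mono_ae hptae
    _ = (ENNReal.ofReal A₀ + ENNReal.ofReal c₀⁻¹ * ∑ d, ∫⁻ V, Md d V * ENNReal.ofReal (Rd d V) ∂μ) +
          ∑ d, ∫⁻ V, Pd d V ∂μ := by
        rw [lintegral_add_left hmain, lintegral_add_left measurable_const, lintegral_const, measure_univ,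
          mul_one, lintegral_const_mul _ hsum, lintegral_finsetSum _ fun d _ => hprod d,
          lintegral_finsetSum _ fun d _ => hPd_meas d]
    _ ≤ (ENNReal.ofReal A₀ + ENNReal.ofReal c₀⁻¹ * ∑ _d : Dir,
          (ENNReal.ofReal (2 * Real.pi)⁻¹ * B * ENNReal.ofReal (δ₀ ^ k)⁻¹)) +
          ∑ _d : Dir, ENNReal.ofReal T * ENNReal.ofReal (C_B * δ₀ ^ m) := by
        gcongr with d _ d _
        · exact hdir d
        · exact hPd_int d
    _ = _ := by
        rw [Finset.sum_const, Finset.sum_const, Finset.card_univ, nsmul_eq_mul, nsmul_eq_mul]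
        ring

end CoreHolder

/-- **The abstract core of the 1-D route, Hölder branch** (explicit-binder form of
`coareaWegner_coreHolder_lintegral_le`, the statement registered for this bridge): pointwise rigidity
bound + circle majorants + slice, with the tube sum replaced by a threshold split at `δ₀ ∈ (0,1]` and a
uniform bound `t ≤ T`, give
`∫⁻ t dμ ≤ A₀ + c₀⁻¹ · #directions · (2π)⁻¹ · B · δ₀^{-k} + T · #directions · C_B δ₀^m` assuming only
`0 < m`. -/
theorem coareaWegner_coreBoundHolder {G : Type*} [Group G] [TopologicalSpace G] [IsTopologicalGroup G]
    [CompactSpace G] [MeasurableSpace G] [BorelSpace G] [SecondCountableTopology G] {ι : Type*} [Fintype ι]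
    [DecidableEq ι] {n : Type*} [Fintype n] [DecidableEq n]
    (Hof : (ι → G) → Matrix n n ℂ) (hHof : Continuous Hof) (hHerm : ∀ V, (Hof V).IsHermitian)
    (tx : (ι → G) → ℝ)
    (b : (ι → G) → ℝ) (hbc : Continuous b)
    (φ : ℝ → ℝ) (hφ : Continuous φ) (hφ0 : ∀ E, 0 ≤ φ E)
    {A₀ c₀ C_B m : ℝ} {k : ℕ} (hA₀ : 0 ≤ A₀) (hc₀ : 0 < c₀) (hm : 0 < m)
    (T : ℝ) (htxT : ∀ V, tx V ≤ T)
    (δ₀ : ℝ) (hδ₀ : 0 < δ₀) (hδ₀1 : δ₀ ≤ 1)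
    (e₀ : ι)
    (hsmall : ∀ (e' : ι) (δ : ℝ), 0 < δ → δ ≤ 1 →
      (Measure.pi fun _ : ι => haarProbability G) {V : ι → G | ∃ g : G, b (Function.update V e' g) < δ} ≤
        ENNReal.ofReal (C_B * δ ^ m))
    {Dir : Type*} [Fintype Dir] (e : Dir → ι) (c : Dir → ℝ → G) (hc0 : ∀ d, c d 0 = 1)
    (hmul : ∀ d s t, c d (s + t) = c d s * c d t) (hcont : ∀ d, Continuous (c d))
    (J : Dir → (ι → G) → (n → ℂ) → ℝ)
    (hJ : ∀ d (V : ι → G) (ψ : n → ℂ),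
      HasDerivAt (fun s => (star ψ ⬝ᵥ (Hof (Function.update V (e d) (V (e d) * c d s))).mulVec ψ).re)
        (J d V ψ) 0)
    (hlip : ∀ d (V : ι → G), ∃ K : NNReal, ∀ i : Fin (Fintype.card n),
      LipschitzWith K fun s => (hHerm (Function.update V (e d) (V (e d) * c d s))).eigenvalues₀ i)
    (hdiffH : ∀ d (V : ι → G), ∃ Hd : Matrix n n ℂ, ∀ p q,
      HasDerivAt (fun s => Hof (Function.update V (e d) (V (e d) * c d s)) p q) (Hd p q) 0)
    {B : ENNReal}
    (harea : ∀ d (V : ι → G), ∑ i : Fin (Fintype.card n), ∫⁻ t in Set.Icc 0 (2 * Real.pi),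
      ENNReal.ofReal (|deriv (fun s => (hHerm (Function.update V (e d) (V (e d) * c d s))).eigenvalues₀ i) t| *
        φ ((hHerm (Function.update V (e d) (V (e d) * c d t))).eigenvalues₀ i)) ≤ B)
    (hpt : ∀ V : ι → G, 0 < b V → tx V ≤ A₀ + (c₀ * b V ^ k)⁻¹ *
      ∑ d, ∑ j : n, (if |(hHerm V).eigenvalues j| ≤ 1 then
        |J d V ⇑((hHerm V).eigenvectorBasis j)| * φ ((hHerm V).eigenvalues j) else 0)) :
    ∫⁻ V, ENNReal.ofReal (tx V) ∂(Measure.pi fun _ : ι => haarProbability G) ≤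
      ENNReal.ofReal A₀ + ENNReal.ofReal c₀⁻¹ * (Fintype.card Dir *
        (ENNReal.ofReal (2 * Real.pi)⁻¹ * B * ENNReal.ofReal (δ₀ ^ k)⁻¹)) +
      ENNReal.ofReal T * (Fintype.card Dir * ENNReal.ofReal (C_B * δ₀ ^ m)) :=
  coareaWegner_coreHolder_lintegral_le Hof hHof hHerm tx b hbc φ hφ hφ0 hA₀ hc₀ hm T htxT δ₀ hδ₀ hδ₀1 e₀
    hsmall e c hc0 hmul hcont J hJ hlip hdiffH harea hpt

end Summit.QuantumFields.QCD.Cruxes.WegnerEstimate.ResolventCell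

end
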